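import Mathlib.Algebra.BigOperators.Group.Finset.Basic
import Mathlib.Data.Multiset.AddSub
import Mathlib.Data.Multiset.UnionInter
import Mathlib.Data.Nat.Dist
import Mathlib.Tactic.Ring
import Mathlib.Tactic.Abel
import Literature.Computability.Cryptography.EditDistFacts
import HarnessLib

/-!
# The q-gram distance of two strings and its bound by the edit distance (Ukkonen 1992)

The *q-gram profile* of a string `x` records, for every string `v` of length `q`, the number
`G_q(x)[v]` of occurrences of `v` in `x` as a (contiguous) substring; the *q-gram distance* of
two strings is the `L¹` distance of their profiles,
`D_q(x, y) = ∑_v |G_q(x)[v] - G_q(y)[v]|` (E. Ukkonen, *Approximate string-matching with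
q-grams and maximal matches*, Theoret. Comput. Sci. 92 (1992) 191–211, §2). Its interest is
the "q-gram lemma": one unit-cost edit operation destroys at most `q` of the q-grams of a string,
so that `D_q(x, y) ≤ 2q · D_E(x, y)` where `D_E` is the Levenshtein distance (Ukkonen 1992,
Theorem 5.1 and the remark following it: "for all strings `x, y`, we have
`D_q(x,y)/(2q) ≤ D_E(x,y)`"). Since `D_q` is computable in linear time, this is the standard
*filter* for edit-distance thresholds (the hybrid method of Ukkonen 1992, §5): a candidate with
`D_q > 2qk` cannot be within edit distance `k`.

## Contents

* `qgrams q x : Multiset (List α)` — the multiset of the `|x| - q + 1` windows of length `q` of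
  `x` (empty if `|x| < q`); `qgramProfile q x v = (qgrams q x).count v` is `G_q(x)[v]`;
  `mem_qgrams_iff` (the q-grams of `x` are exactly its infixes of length `q`), `card_qgrams`.
* `qgramDist q x y : ℕ` — the q-gram distance, defined as
  `#(qgrams q x - qgrams q y) + #(qgrams q y - qgrams q x)` (multiset differences) and identified
  with the printed `L¹` formula in `qgramDist_eq_sum_dist`.
* Theorem 2.1 of Ukkonen 1992: `qgramDist` is a pseudometric (`qgramDist_comm`, `qgramDist_self`,
  `qgramDist_triangle`), vanishing exactly on strings with the same profile
  (`qgramDist_eq_zero_iff`), which need not be equal (an `example`); the length bounds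
  `length_sub_length_le_qgramDist`, `qgramDist_le`, and Theorem 2.2(ii)
  (`length_eq_of_qgramDist_eq_zero`).
* The effect of one edit operation applied after a prefix `u`
  (`card_qgrams_sub_le_of_delete` `≤ q`, `card_qgrams_sub_le_of_insert` `≤ q - 1`,
  `card_qgrams_sub_le_of_subst` `≤ q`; Ukkonen 1992, proof of Theorem 5.1), obtained from the
  decomposition `exists_qgrams_append` of the q-grams of a concatenation `u ++ w` into those of
  `u`, those of `w`, and at most `q - 1` windows across the junction.
* The q-gram lemma, one-sided (`card_qgrams_sub_le_mul_editDist`: at most `q · D_E(x,y)` of the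
  q-grams of `x` are missing from `y`; shared-count form
  `length_add_one_sub_le_card_inter_add_mul_editDist`) and two-sided
  (`qgramDist_le_two_mul_mul_editDist`: `D_q(x,y) ≤ 2q · D_E(x,y)`; filter form
  `qgramDist_le_of_editDist_le`; an `example` shows the constant `2q` is attained).

## References

* E. Ukkonen, *Approximate string-matching with q-grams and maximal matches*, Theoretical
  Computer Science 92 (1992) 191–211, §2 (Definitions, Theorems 2.1, 2.2) and §5 (Theorem 5.1 and
  the remark after its proof). [Ukkonen1992]
* The edit distance is `Literature.Computability.Cryptography.editDist` (`SequenceProblems`,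
  `EditDistFacts`: Wagner–Fischer recursion, unit costs, `editDist_comm'`).

## Design

* q-grams are collected in a `Multiset`, so that the profile is `Multiset.count` and the `L¹`
  distance of profiles is the sum of the cardinalities of the two multiset differences; the
  printed sum over `v ∈ Σ^q` is recovered over any finite set of strings containing the q-grams
  of both arguments (`qgramDist_eq_sum_dist`), so no finiteness of the alphabet is needed.
* The case `q = 0` is allowed in the definitions (every position then carries the empty
  `0`-gram, `|x| + 1` of them); the statements relating to the edit distance assume `0 < q` as in
  print ("let `q > 0` be an integer").
* The proof of the q-gram lemma is by the functional induction principle of `editDist`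
  (one edit operation at the head of the remaining suffixes, after an arbitrary common prefix
  `u`), not via traces; the three one-operation bounds are exactly the counting in Ukkonen's
  proof of Theorem 5.1 ("a deletion or a change at character `p_i` of `P` destroys at most `q`
  q-grams of `P` … an insertion between `p_i` and `p_{i+1}` destroys at most `q - 1` q-grams").
* Not here: the algorithmics of §§3–4 (linear-time evaluation, suffix automata, maximal
  matches) and the sharper threshold filters of later literature.
-/

namespace Literature.Computability.StringMatching

open Literature.Computability.Cryptography

variable {α : Type*}

/-! ### q-grams and the q-gram profile -/

/-- The window of length `q` at the head of `s`, as a multiset with at most one element: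
`{s.take q}` if `q ≤ |s|`, and `0` if `s` is too short to carry a q-gram (Ukkonen 1992, §2:
"`x` has an occurrence of `v = a_i ⋯ a_{i+q-1}`"). [cite: Ukkonen1992, §2] -/
def qgramWindow (q : ℕ) (s : List α) : Multiset (List α) :=
  if q ≤ s.length then {s.take q} else 0

/-- The multiset of **q-grams** of a string `x`: the windows `x[i..i+q)` for
`0 ≤ i ≤ |x| - q`, with multiplicity (Ukkonen 1992, §2; the q-gram profile `G_q(x)` is its
counting function, `qgramProfile`). Defined by recursion on `x`: the q-grams of `a :: s` are the
head window of `a :: s` (if `|a :: s| ≥ q`) together with the q-grams of `s`.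
[cite: Ukkonen1992, §2] -/
def qgrams (q : ℕ) : List α → Multiset (List α)
  | [] => qgramWindow q []
  | a :: s => qgramWindow q (a :: s) + qgrams q s

/-- `qgrams q [] = qgramWindow q []` (which is `0` unless `q = 0`). [cite: Ukkonen1992, §2] -/
@[simp]
theorem qgrams_nil (q : ℕ) : qgrams q ([] : List α) = qgramWindow q [] := rfl

/-- The defining recursion: `qgrams q (a :: s) = qgramWindow q (a :: s) + qgrams q s`.
[cite: Ukkonen1992, §2] -/
@[simp]
theorem qgrams_cons (q : ℕ) (a : α) (s : List α) :
    qgrams q (a :: s) = qgramWindow q (a :: s) + qgrams q s := rfl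

/-- A window multiset has at most one element. [folklore] -/
private theorem card_qgramWindow_le_one (q : ℕ) (s : List α) :
    Multiset.card (qgramWindow q s) ≤ 1 := by
  unfold qgramWindow
  split_ifs <;> simp

/-- `#(qgramWindow q s) = [q ≤ |s|]`. [folklore] -/
private theorem card_qgramWindow (q : ℕ) (s : List α) :
    Multiset.card (qgramWindow q s) = if q ≤ s.length then 1 else 0 := by
  unfold qgramWindow
  split_ifs <;> simp

/-- A string of length `n` has `n - q + 1` q-grams counted with multiplicity (and none if
`n < q`): `#(qgrams q x) = |x| + 1 - q` (Ukkonen 1992, §2, "let `v_i`, `1 ≤ i ≤ n - q + 1`, be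
the q-grams of `x`"). [cite: Ukkonen1992, §2] -/
theorem card_qgrams (q : ℕ) (x : List α) :
    Multiset.card (qgrams q x) = x.length + 1 - q := by
  induction x with
  | nil =>
      rw [qgrams_nil, card_qgramWindow]
      simp only [List.length_nil, nonpos_iff_eq_zero, zero_add]
      split_ifs <;> omega
  | cons a s ih =>
      rw [qgrams_cons, Multiset.card_add, card_qgramWindow, ih]
      simp only [List.length_cons]
      split_ifs <;> omega

/-- Membership in a window multiset. [folklore] -/
private theorem mem_qgramWindow_iff {q : ℕ} {s v : List α} :
    v ∈ qgramWindow q s ↔ q ≤ s.length ∧ v = s.take q := by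
  unfold qgramWindow
  split_ifs with h <;> simp [h]

/-- The q-grams of `x` are exactly the substrings (infixes) of `x` of length `q`
(Ukkonen 1992, §2, Definition: "`x` has an occurrence of `v`"). [cite: Ukkonen1992, §2] -/
theorem mem_qgrams_iff {q : ℕ} {x v : List α} :
    v ∈ qgrams q x ↔ v <:+: x ∧ v.length = q := by
  induction x with
  | nil =>
      rw [qgrams_nil, mem_qgramWindow_iff]
      constructor
      · rintro ⟨hq, rfl⟩
        simp only [List.length_nil, nonpos_iff_eq_zero] at hq
        subst hq
        simp
      · rintro ⟨h, hl⟩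
        rw [List.infix_nil] at h
        subst h
        simp only [List.length_nil] at hl
        subst hl
        simp
  | cons a s ih =>
      rw [qgrams_cons, Multiset.mem_add, ih, mem_qgramWindow_iff, List.infix_cons_iff]
      constructor
      · rintro (⟨hq, rfl⟩ | ⟨h, hl⟩)
        · refine ⟨Or.inl (List.take_prefix _ _), ?_⟩
          rw [List.length_take]
          omega
        · exact ⟨Or.inr h, hl⟩
      · rintro ⟨h | h, hl⟩
        · left
          have hle := h.length_le
          refine ⟨by rw [← hl]; exact hle, ?_⟩
          rw [List.prefix_iff_eq_take] at h
          rw [h, hl]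
        · exact Or.inr ⟨h, hl⟩

/-! ### The q-grams of a concatenation -/

/-- If `u` is long enough to carry a q-gram, the head window of `u ++ w` is that of `u`.
[folklore] -/
private theorem qgramWindow_append_of_le {q : ℕ} {u : List α} (h : q ≤ u.length)
    (w : List α) :
    qgramWindow q (u ++ w) = qgramWindow q u := by
  unfold qgramWindow
  rw [if_pos h, if_pos (h.trans (by simp)), List.take_append_of_le_length h]

/-- The q-grams of a concatenation `u ++ w` (`q ≥ 1`) are the q-grams of `u`, the q-grams of
`w`, and a multiset `J` of at most `min |u| (q - 1)` windows across the junction (those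
containing both a letter of `u` and a letter of `w`) (Ukkonen 1992, proof of Thm 5.1: the
q-grams "that contain both `p_i` and `p_{i+1}`"). [cite: Ukkonen1992, Thm 5.1 (proof)] -/
theorem exists_qgrams_append {q : ℕ} (hq : 0 < q) (u w : List α) :
    ∃ J : Multiset (List α), qgrams q (u ++ w) = qgrams q u + J + qgrams q w ∧
      Multiset.card J ≤ min u.length (q - 1) := by
  induction u with
  | nil =>
      refine ⟨0, ?_, by simp⟩
      have h : q ≠ 0 := by omega
      simp [qgramWindow, h]
  | cons a u ih =>
      obtain ⟨J, hJ, hc⟩ := ih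
      by_cases h : q ≤ (a :: u).length
      · refine ⟨J, ?_, ?_⟩
        · rw [List.cons_append, qgrams_cons, qgrams_cons, ← List.cons_append,
            qgramWindow_append_of_le h, hJ]
          simp only [add_assoc]
        · simp only [List.length_cons] at hc ⊢
          omega
      · refine ⟨qgramWindow q (a :: u ++ w) + J, ?_, ?_⟩
        · have hW : qgramWindow q (a :: u) = 0 := by
            unfold qgramWindow
            rw [if_neg h]
          rw [List.cons_append, qgrams_cons, qgrams_cons, hJ, hW, ← List.cons_append]
          abel
        · have h1 := card_qgramWindow_le_one q (a :: u ++ w)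
          rw [Multiset.card_add]
          simp only [List.length_cons] at h hc ⊢
          omega

section Profile

variable [DecidableEq α]

/-- The **q-gram profile** `G_q(x)[v]`: the number of occurrences of `v` in `x` as a q-gram
(Ukkonen 1992, §2, Definition). [cite: Ukkonen1992, §2] -/
def qgramProfile (q : ℕ) (x : List α) (v : List α) : ℕ :=
  (qgrams q x).count v

/-- The **q-gram distance** `D_q(x, y) = ∑_v |G_q(x)[v] - G_q(y)[v]|`, the `L¹` distance of the
q-gram profiles (Ukkonen 1992, §2, Definition), written as the number of q-grams of `x` missing
from `y` plus the number of q-grams of `y` missing from `x` (multiset differences, with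
multiplicity); the printed sum is `qgramDist_eq_sum_dist`. [cite: Ukkonen1992, §2] -/
def qgramDist (q : ℕ) (x y : List α) : ℕ :=
  Multiset.card (qgrams q x - qgrams q y) + Multiset.card (qgrams q y - qgrams q x)

/-- The multiset form of `qgramDist` agrees with the printed `L¹` formula
`D_q(x, y) = ∑_v |G_q(x)[v] - G_q(y)[v]|`, the sum ranging over any finite set of strings
containing every q-gram of `x` and of `y` (e.g. `Σ^q` for a finite alphabet); here
`Nat.dist m n = (m - n) + (n - m) = |m - n|` (Ukkonen 1992, §2, Definition).
[cite: Ukkonen1992, §2] -/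
theorem qgramDist_eq_sum_dist (q : ℕ) (x y : List α) (s : Finset (List α))
    (hx : ∀ v ∈ qgrams q x, v ∈ s) (hy : ∀ v ∈ qgrams q y, v ∈ s) :
    qgramDist q x y = ∑ v ∈ s, Nat.dist (qgramProfile q x v) (qgramProfile q y v) := by
  unfold qgramDist qgramProfile Nat.dist
  have hx' : ∀ v ∈ qgrams q x - qgrams q y, v ∈ s :=
    fun v hv => hx v (Multiset.mem_of_le (Multiset.sub_le_self _ _) hv)
  have hy' : ∀ v ∈ qgrams q y - qgrams q x, v ∈ s :=
    fun v hv => hy v (Multiset.mem_of_le (Multiset.sub_le_self _ _) hv)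
  rw [Finset.sum_add_distrib, ← Multiset.sum_count_eq_card hx', ← Multiset.sum_count_eq_card hy']
  simp only [Multiset.count_sub]

/-- `qgramDist_eq_sum_dist` over the canonical index set: the distinct q-grams of `x` and `y`.
[cite: Ukkonen1992, §2] -/
theorem qgramDist_eq_sum_dist_toFinset (q : ℕ) (x y : List α) :
    qgramDist q x y =
      ∑ v ∈ (qgrams q x + qgrams q y).toFinset,
        Nat.dist (qgramProfile q x v) (qgramProfile q y v) :=
  qgramDist_eq_sum_dist q x y _
    (fun _ hv => Multiset.mem_toFinset.mpr (Multiset.mem_add.mpr (Or.inl hv)))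
    (fun _ hv => Multiset.mem_toFinset.mpr (Multiset.mem_add.mpr (Or.inr hv)))

/-! ### Theorem 2.1: a pseudometric, not a metric -/

/-- Bookkeeping for multiset differences: `#(s - r) ≤ #(s - t) + #(t - r)` (pointwise
`a - c ≤ (a - b) + (b - c)` on counts). [folklore] -/
private theorem card_sub_le_card_sub_add_card_sub {β : Type*} [DecidableEq β]
    (s t r : Multiset β) :
    Multiset.card (s - r) ≤ Multiset.card (s - t) + Multiset.card (t - r) := by
  rw [← Multiset.card_add]
  apply Multiset.card_le_card
  simp only [Multiset.le_iff_count, Multiset.count_add, Multiset.count_sub]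
  intro a
  omega

/-- Bookkeeping: if `s ≤ r + t` then `#(s - t) ≤ #r`. [folklore] -/
private theorem card_sub_le_card_of_le_add {β : Type*} [DecidableEq β] {s t r : Multiset β}
    (h : s ≤ r + t) : Multiset.card (s - t) ≤ Multiset.card r :=
  Multiset.card_le_card (Multiset.sub_le_iff_le_add.mpr h)

/-- Theorem 2.1 (symmetry): `D_q(x, y) = D_q(y, x)` (Ukkonen 1992, Thm 2.1).
[cite: Ukkonen1992, Thm 2.1] -/
theorem qgramDist_comm (q : ℕ) (x y : List α) : qgramDist q x y = qgramDist q y x :=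
  Nat.add_comm _ _

/-- Theorem 2.1: `D_q(x, x) = 0` (Ukkonen 1992, Thm 2.1). [cite: Ukkonen1992, Thm 2.1] -/
@[simp]
theorem qgramDist_self (q : ℕ) (x : List α) : qgramDist q x x = 0 := by
  simp [qgramDist]

/-- Theorem 2.1 (triangle inequality): `D_q(x, z) ≤ D_q(x, y) + D_q(y, z)`; with symmetry and
`D_q(x,x) = 0`, "the q-gram distance is a pseudometric" (Ukkonen 1992, Thm 2.1).
[cite: Ukkonen1992, Thm 2.1] -/
theorem qgramDist_triangle (q : ℕ) (x y z : List α) :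
    qgramDist q x z ≤ qgramDist q x y + qgramDist q y z := by
  unfold qgramDist
  have h1 := card_sub_le_card_sub_add_card_sub (qgrams q x) (qgrams q y) (qgrams q z)
  have h2 := card_sub_le_card_sub_add_card_sub (qgrams q z) (qgrams q y) (qgrams q x)
  omega

/-- `D_q(x, y) = 0` exactly when `x` and `y` have identical q-gram profiles ("It is not a
metric as `D_q(x, y)` can be `0` even if `x ≠ y`. This is the case if `x` and `y` have identical
q-gram profiles", Ukkonen 1992, after Thm 2.1). [cite: Ukkonen1992, Thm 2.1] -/
theorem qgramDist_eq_zero_iff {q : ℕ} {x y : List α} :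
    qgramDist q x y = 0 ↔ qgrams q x = qgrams q y := by
  constructor
  · intro h
    have h1 : qgrams q x - qgrams q y = 0 :=
      Multiset.card_eq_zero.mp (by unfold qgramDist at h; omega)
    have h2 : qgrams q y - qgrams q x = 0 :=
      Multiset.card_eq_zero.mp (by unfold qgramDist at h; omega)
    ext v
    have c1 := congrArg (Multiset.count v) h1
    have c2 := congrArg (Multiset.count v) h2
    simp only [Multiset.count_sub, Multiset.count_zero] at c1 c2
    omega
  · intro h
    simp [qgramDist, h]

/- Example (not a metric): distinct strings with the same 2-gram profile, `D_2 = 0` — `abaa`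
and `aaba` over `{a, b}` both have the 2-grams `ab, ba, aa` (Ukkonen 1992, after Thm 2.1, and
Thm 2.2, transposition rule). -/
example :
    qgramDist 2 ([0, 1, 0, 0] : List (Fin 2)) [0, 0, 1, 0] = 0 ∧
      ([0, 1, 0, 0] : List (Fin 2)) ≠ [0, 0, 1, 0] := by
  decide

/-- Lower length bound. By Ukkonen 1992, §2, a string `x` has `|x| - q + 1` q-grams
(`card_qgrams`: the profiles of `x` and `y` have total masses `|x| + 1 - q` and `|y| + 1 - q`),
hence `(|x| + 1 - q) - (|y| + 1 - q) ≤ D_q(x, y)`; in particular `| |x| - |y| | ≤ D_q(x, y)` when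
both strings have length `≥ q` (immediate consequence of the q-gram count of §2).
[cite: Ukkonen1992, §2] -/
theorem length_sub_length_le_qgramDist (q : ℕ) (x y : List α) :
    (x.length + 1 - q) - (y.length + 1 - q) ≤ qgramDist q x y := by
  have h : Multiset.card (qgrams q x) ≤
      Multiset.card (qgrams q x - qgrams q y) + Multiset.card (qgrams q y) := by
    rw [← Multiset.card_add]
    exact Multiset.card_le_card le_tsub_add
  rw [card_qgrams, card_qgrams] at h
  unfold qgramDist
  omega

/-- Upper length bound: `D_q(x, y) ≤ (|x| + 1 - q) + (|y| + 1 - q)`, the total number of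
q-grams of the two strings (immediate consequence of the q-gram count `|x| - q + 1` of
Ukkonen 1992, §2, `card_qgrams`). [cite: Ukkonen1992, §2] -/
theorem qgramDist_le (q : ℕ) (x y : List α) :
    qgramDist q x y ≤ (x.length + 1 - q) + (y.length + 1 - q) := by
  unfold qgramDist
  have h1 := Multiset.card_le_card (Multiset.sub_le_self (qgrams q x) (qgrams q y))
  have h2 := Multiset.card_le_card (Multiset.sub_le_self (qgrams q y) (qgrams q x))
  rw [card_qgrams] at h1 h2
  omega

/-- Theorem 2.2(ii): if `q ≤ |x|`, every string with the same q-gram profile as `x` has length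
`|x|` (Ukkonen 1992, Thm 2.2(ii)). [cite: Ukkonen1992, Thm 2.2(ii)] -/
theorem length_eq_of_qgramDist_eq_zero {q : ℕ} {x y : List α} (hq : q ≤ x.length)
    (h : qgramDist q x y = 0) : y.length = x.length := by
  have h1 := length_sub_length_le_qgramDist q x y
  have h2 := length_sub_length_le_qgramDist q y x
  rw [qgramDist_comm] at h2
  omega

/-! ### One edit operation -/

/-- A deletion (after a prefix `u`) destroys at most `q` q-grams: at most `q` of the q-grams of
`u a v` are missing from `u v`, namely those containing the deleted letter (Ukkonen 1992, proof
of Thm 5.1: "A deletion or a change at character `p_i` of `P` destroys at most `q` q-grams of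
`P`, namely, those that contain `p_i`"). [cite: Ukkonen1992, Thm 5.1 (proof)] -/
theorem card_qgrams_sub_le_of_delete {q : ℕ} (hq : 0 < q) (u v : List α) (a : α) :
    Multiset.card (qgrams q (u ++ a :: v) - qgrams q (u ++ v)) ≤ q := by
  obtain ⟨J₁, h₁, c₁⟩ := exists_qgrams_append hq u (a :: v)
  obtain ⟨J₂, h₂, c₂⟩ := exists_qgrams_append hq u v
  have hW := card_qgramWindow_le_one q (a :: v)
  calc Multiset.card (qgrams q (u ++ a :: v) - qgrams q (u ++ v))
      ≤ Multiset.card (J₁ + qgramWindow q (a :: v)) := by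
        apply card_sub_le_card_of_le_add
        rw [h₁, h₂, qgrams_cons]
        simp only [Multiset.le_iff_count, Multiset.count_add]
        intro t
        omega
    _ ≤ q := by
        rw [Multiset.card_add]
        have := min_le_right u.length (q - 1)
        omega

/-- An insertion (after a prefix `u`) destroys at most `q - 1` q-grams: at most `q - 1` of the
q-grams of `u v` are missing from `u a v`, namely those across the insertion point (Ukkonen 1992,
proof of Thm 5.1: "An insertion between `p_i` and `p_{i+1}` destroys at most `q - 1` q-grams of
`P`, namely, those that contain both `p_i` and `p_{i+1}`"). [cite: Ukkonen1992, Thm 5.1 (proof)] -/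
theorem card_qgrams_sub_le_of_insert {q : ℕ} (hq : 0 < q) (u v : List α) (a : α) :
    Multiset.card (qgrams q (u ++ v) - qgrams q (u ++ a :: v)) ≤ q - 1 := by
  obtain ⟨J₁, h₁, c₁⟩ := exists_qgrams_append hq u (a :: v)
  obtain ⟨J₂, h₂, c₂⟩ := exists_qgrams_append hq u v
  calc Multiset.card (qgrams q (u ++ v) - qgrams q (u ++ a :: v))
      ≤ Multiset.card J₂ := by
        apply card_sub_le_card_of_le_add
        rw [h₁, h₂, qgrams_cons]
        simp only [Multiset.le_iff_count, Multiset.count_add]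
        intro t
        omega
    _ ≤ q - 1 := c₂.trans (min_le_right _ _)

/-- A substitution ("change", after a prefix `u`) destroys at most `q` q-grams: at most `q` of
the q-grams of `u a v` are missing from `u b v` (Ukkonen 1992, proof of Thm 5.1).
[cite: Ukkonen1992, Thm 5.1 (proof)] -/
theorem card_qgrams_sub_le_of_subst {q : ℕ} (hq : 0 < q) (u v : List α) (a b : α) :
    Multiset.card (qgrams q (u ++ a :: v) - qgrams q (u ++ b :: v)) ≤ q := by
  obtain ⟨J₁, h₁, c₁⟩ := exists_qgrams_append hq u (a :: v)
  obtain ⟨J₃, h₃, c₃⟩ := exists_qgrams_append hq u (b :: v)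
  have hW := card_qgramWindow_le_one q (a :: v)
  calc Multiset.card (qgrams q (u ++ a :: v) - qgrams q (u ++ b :: v))
      ≤ Multiset.card (J₁ + qgramWindow q (a :: v)) := by
        apply card_sub_le_card_of_le_add
        rw [h₁, h₃, qgrams_cons, qgrams_cons]
        simp only [Multiset.le_iff_count, Multiset.count_add]
        intro t
        omega
    _ ≤ q := by
        rw [Multiset.card_add]
        have := min_le_right u.length (q - 1)
        omega

/-- Appending `y` to `u` destroys at most `(q - 1)·|y|` of the q-grams of `u` (iterated
insertion bound). [cite: Ukkonen1992, Thm 5.1 (proof)] -/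
theorem card_qgrams_sub_qgrams_append_le {q : ℕ} (hq : 0 < q) (u y : List α) :
    Multiset.card (qgrams q u - qgrams q (u ++ y)) ≤ (q - 1) * y.length := by
  induction y generalizing u with
  | nil => simp
  | cons b y ih =>
      calc Multiset.card (qgrams q u - qgrams q (u ++ b :: y))
          ≤ Multiset.card (qgrams q u - qgrams q (u ++ [b])) +
              Multiset.card (qgrams q (u ++ [b]) - qgrams q (u ++ b :: y)) :=
            card_sub_le_card_sub_add_card_sub _ _ _
        _ ≤ (q - 1) + (q - 1) * y.length := by
            apply add_le_add
            · simpa using card_qgrams_sub_le_of_insert hq u [] b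
            · simpa [List.append_assoc] using ih (u ++ [b])
        _ = (q - 1) * (b :: y).length := by
            simp only [List.length_cons]
            ring

/-- Deleting a suffix `x` of `u x` destroys at most `q·|x|` of its q-grams (iterated deletion
bound). [cite: Ukkonen1992, Thm 5.1 (proof)] -/
theorem card_qgrams_append_sub_qgrams_le {q : ℕ} (hq : 0 < q) (u x : List α) :
    Multiset.card (qgrams q (u ++ x) - qgrams q u) ≤ q * x.length := by
  induction x with
  | nil => simp
  | cons a x ih =>
      calc Multiset.card (qgrams q (u ++ a :: x) - qgrams q u)
          ≤ Multiset.card (qgrams q (u ++ a :: x) - qgrams q (u ++ x)) +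
              Multiset.card (qgrams q (u ++ x) - qgrams q u) :=
            card_sub_le_card_sub_add_card_sub _ _ _
        _ ≤ q + q * x.length := add_le_add (card_qgrams_sub_le_of_delete hq u x a) ih
        _ = q * (a :: x).length := by
            simp only [List.length_cons]
            ring

/-! ### The q-gram lemma (Theorem 5.1) -/

/-- The q-gram lemma behind an arbitrary common prefix `u`: at most `q · D_E(x, y)` of the
q-grams of `u x` are missing from `u y`. Proved along the Wagner–Fischer recursion of
`editDist`: each deletion or substitution costs at most `q` q-grams, each insertion at most
`q - 1`, a match nothing (Ukkonen 1992, Thm 5.1, proof). [cite: Ukkonen1992, Thm 5.1] -/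
theorem card_qgrams_sub_le_mul_editDist_prefix {q : ℕ} (hq : 0 < q) (x y : List α) :
    ∀ u : List α,
      Multiset.card (qgrams q (u ++ x) - qgrams q (u ++ y)) ≤ q * editDist x y := by
  induction x, y using editDist.induct with
  | case1 ys =>
      intro u
      rw [editDist_nil_left, List.append_nil]
      calc Multiset.card (qgrams q u - qgrams q (u ++ ys))
          ≤ (q - 1) * ys.length := card_qgrams_sub_qgrams_append_le hq u ys
        _ ≤ q * ys.length := Nat.mul_le_mul_right _ (Nat.sub_le q 1)
  | case2 a xs =>
      intro u
      rw [editDist_nil_right, List.append_nil]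
      exact card_qgrams_append_sub_qgrams_le hq u (a :: xs)
  | case3 a xs b ys ih1 ih2 ih3 =>
      intro u
      have hA : Multiset.card (qgrams q (u ++ a :: xs) - qgrams q (u ++ b :: ys)) ≤
          q * (editDist xs (b :: ys) + 1) := by
        calc Multiset.card (qgrams q (u ++ a :: xs) - qgrams q (u ++ b :: ys))
            ≤ Multiset.card (qgrams q (u ++ a :: xs) - qgrams q (u ++ xs)) +
                Multiset.card (qgrams q (u ++ xs) - qgrams q (u ++ b :: ys)) :=
              card_sub_le_card_sub_add_card_sub _ _ _
          _ ≤ q + q * editDist xs (b :: ys) :=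
              add_le_add (card_qgrams_sub_le_of_delete hq u xs a) (ih1 u)
          _ = q * (editDist xs (b :: ys) + 1) := by ring
      have hB : Multiset.card (qgrams q (u ++ a :: xs) - qgrams q (u ++ b :: ys)) ≤
          q * (editDist (a :: xs) ys + 1) := by
        calc Multiset.card (qgrams q (u ++ a :: xs) - qgrams q (u ++ b :: ys))
            ≤ Multiset.card (qgrams q (u ++ a :: xs) - qgrams q (u ++ ys)) +
                Multiset.card (qgrams q (u ++ ys) - qgrams q (u ++ b :: ys)) :=
              card_sub_le_card_sub_add_card_sub _ _ _
          _ ≤ q * editDist (a :: xs) ys + (q - 1) :=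
              add_le_add (ih2 u) (card_qgrams_sub_le_of_insert hq u ys b)
          _ ≤ q * (editDist (a :: xs) ys + 1) := by
              rw [mul_add, mul_one]
              exact Nat.add_le_add_left (Nat.sub_le q 1) _
      have hC : Multiset.card (qgrams q (u ++ a :: xs) - qgrams q (u ++ b :: ys)) ≤
          q * (editDist xs ys + if a = b then 0 else 1) := by
        split_ifs with hab
        · subst hab
          simpa [List.append_assoc] using ih3 (u ++ [a])
        · calc Multiset.card (qgrams q (u ++ a :: xs) - qgrams q (u ++ b :: ys))
              ≤ Multiset.card (qgrams q (u ++ a :: xs) - qgrams q (u ++ b :: xs)) +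
                  Multiset.card (qgrams q (u ++ b :: xs) - qgrams q (u ++ b :: ys)) :=
                card_sub_le_card_sub_add_card_sub _ _ _
            _ ≤ q + q * editDist xs ys :=
                add_le_add (card_qgrams_sub_le_of_subst hq u xs a b)
                  (by simpa [List.append_assoc] using ih3 (u ++ [b]))
            _ = q * (editDist xs ys + 1) := by ring
      rw [editDist_cons_cons]
      generalize (if a = b then 0 else 1) = c at hC ⊢
      generalize editDist xs (b :: ys) = e₁ at hA ⊢
      generalize editDist (a :: xs) ys = e₂ at hB ⊢
      generalize editDist xs ys = e₃ at hC ⊢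
      generalize Multiset.card (qgrams q (u ++ a :: xs) - qgrams q (u ++ b :: ys)) = L at hA hB hC ⊢
      have hm : min (e₁ + 1) (min (e₂ + 1) (e₃ + c)) = e₁ + 1 ∨
          min (e₁ + 1) (min (e₂ + 1) (e₃ + c)) = e₂ + 1 ∨
          min (e₁ + 1) (min (e₂ + 1) (e₃ + c)) = e₃ + c := by omega
      rcases hm with hm | hm | hm <;> rw [hm] <;> assumption

/-- **The q-gram lemma** (one-sided form): at most `q · D_E(x, y)` of the q-grams of `x`
(counted with multiplicity) are missing from `y` — equivalently `x` and `y` share at least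
`|x| - q + 1 - q·D_E(x, y)` q-grams (Ukkonen 1992, Thm 5.1 and its proof: "at most `dq` of the
q-grams of `P` are missing"). [cite: Ukkonen1992, Thm 5.1] -/
theorem card_qgrams_sub_le_mul_editDist {q : ℕ} (hq : 0 < q) (x y : List α) :
    Multiset.card (qgrams q x - qgrams q y) ≤ q * editDist x y := by
  simpa using card_qgrams_sub_le_mul_editDist_prefix hq x y []

/-- **The q-gram lemma** (shared-count form): two strings at edit distance `d` have at least
`|x| - q + 1 - qd` q-grams in common (with multiplicity), i.e.
`|x| + 1 - q ≤ #(qgrams q x ∩ qgrams q y) + q · D_E(x, y)` — the threshold used by q-gram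
filtration (Ukkonen 1992, Thm 5.1, proof: of the `m - q + 1` q-grams of `P` "at most `dq` … are
not present"). [cite: Ukkonen1992, Thm 5.1] -/
theorem length_add_one_sub_le_card_inter_add_mul_editDist {q : ℕ} (hq : 0 < q) (x y : List α) :
    x.length + 1 - q ≤ Multiset.card (qgrams q x ∩ qgrams q y) + q * editDist x y := by
  have h1 := card_qgrams_sub_le_mul_editDist hq x y
  have h2 : Multiset.card (qgrams q x) =
      Multiset.card (qgrams q x - qgrams q y) + Multiset.card (qgrams q x ∩ qgrams q y) := by
    rw [← Multiset.card_add, Multiset.sub_add_inter]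
  rw [card_qgrams] at h2
  omega

/-- **The q-gram distance is at most `2q` times the edit distance**: for all strings `x, y` and
`q ≥ 1`, `D_q(x, y) ≤ 2q · D_E(x, y)` (Ukkonen 1992, Thm 5.1 and the remark after its proof:
"for all strings `x, y`, we have `D_q(x, y)/(2q) ≤ D_E(x, y)`"). This is the q-gram filter for
the `k`-differences problem: `D_q(x, y) > 2qk` implies `D_E(x, y) > k`.
[cite: Ukkonen1992, Thm 5.1] -/
theorem qgramDist_le_two_mul_mul_editDist {q : ℕ} (hq : 0 < q) (x y : List α) :
    qgramDist q x y ≤ 2 * q * editDist x y := by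
  have h1 := card_qgrams_sub_le_mul_editDist hq x y
  have h2 := card_qgrams_sub_le_mul_editDist hq y x
  rw [editDist_comm' y x] at h2
  unfold qgramDist
  calc Multiset.card (qgrams q x - qgrams q y) + Multiset.card (qgrams q y - qgrams q x)
      ≤ q * editDist x y + q * editDist x y := add_le_add h1 h2
    _ = 2 * q * editDist x y := by ring

/-- The filter form: strings within edit distance `k` are within q-gram distance `2qk`
(Ukkonen 1992, §5, the hybrid method: "Mark all `i` such that `d_i/(2q) ≤ k` … only such
`de_i` can be `≤ k` by Theorem 5.1"). [cite: Ukkonen1992, Thm 5.1] -/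
theorem qgramDist_le_of_editDist_le {q k : ℕ} (hq : 0 < q) {x y : List α}
    (h : editDist x y ≤ k) : qgramDist q x y ≤ 2 * q * k :=
  (qgramDist_le_two_mul_mul_editDist hq x y).trans (Nat.mul_le_mul_left _ h)

/- Example (the constant `2q` is attained): one substitution in the middle of `a^{2q-1}` changes
all `q` q-grams; for `q = 2`, `D_2(aaa, aba) = 4 = 2·2·D_E(aaa, aba)`. -/
example :
    qgramDist 2 ([0, 0, 0] : List (Fin 2)) [0, 1, 0] = 4 ∧
      editDist ([0, 0, 0] : List (Fin 2)) [0, 1, 0] = 1 := by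
  refine ⟨by decide, ?_⟩
  rw [editDist_cons_cons_same, editDist_cons_cons]
  simp

end Profile

end Literature.Computability.StringMatching
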